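import Summits.CriticalPhenomena.PercolationContinuityZ3.Theorems.PercNearOneGluingNoHeavyQuantGatedSliceWindow
import Summits.CriticalPhenomena.PercolationContinuityZ3.Theorems.PercNearOneGluingNoHeavyQuantFlowUncross
import HarnessLib

/-!
# QUANT lane R8, T-DEC, leg (III), blob case — `LawDec.GatedSliceMixLaw` AS TYPED IS FALSE (`not_gatedSliceMixLaw`): when the weak-mid law `W_h`
# is itself DEC but exactly tight and shares its only absorber with `P[μ₂]`, only `θ = 1` mixes to a DEC law; the corrected statement is
# `GatedSliceMixLaw'` (`…QuantGatedSliceMixLawPrime`: `W_h` non-DEC), which is all the reduction uses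

builds on p205010 (kernel theorem, internal audit signed; external expert review pending)

Support file (`--supports stmt-CriticalPhenomena-4575`), QUANT lane typer seat prim-quant-stmt (gen 29), rung R8 of
`run/shared/lean/prim/quant/LADDER.md`.  Theorems only, standard axioms, no sorries, no definitions.  Memo GATED-SLICE-DUAL-G29 §8.

THE WITNESS (typer g29; found when the census LP was corrected to demand `θ < 1`).  `y = 7/8`, `z = 0`, `g = 1`, `S = 63/8`, `a = 2`, `j = M = 9`, `h = 9`,
`μ₂ = {1, 9; 55/64}` (mean `63/8`), target `t = 79/8`, `u = 7`.  `W_9 = δ₀/8 + 7δ₁₁/8` (DEC, exactly tight: `7·(1/8) = 7/8`); `P[μ₂] = slice μ₂ 2 1 =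
9δ₃/64 + 55δ₁₁/64` (the low `3` needs `63/64 > 55/64` of giant mass).  For `θ < 1` the mixture `Q_θ` has lows `0` (`θ/8`) and `3` (`9(1−θ)/64`) and the
single useful absorber `11` (`7θ/8 + 55(1−θ)/64`); the price system `α₀ = α₃ = 7`, `β₁₀ = β₁₁ = 1`, `β₇ = β₈ = β₉ = 2` (valid: `usage(3,7) = 31`,
`usage(3,8) = 69/11`, `usage(3,9) = 325/59`, giants `7`) has value `7θ/8 + 63(1−θ)/64 − 7θ/8 − 55(1−θ)/64 = (1−θ)/8 > 0`, contradicting weak duality.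

* `LawDec.usage_gsm_giant`, `usage_gsm_37`, `usage_gsm_38`, `usage_gsm_39` — the rates at `(7/8, 79/8, 9)`.
* **`LawDec.not_gatedSliceMixLaw : ¬ GatedSliceMixLaw`.**

[this work].  The gluing rows served [cite: KozmaNitzan2024, Conjecture 3 (p. 15)]; product measure [cite: Grimmett1999, §1.3 p. 10].
-/

noncomputable section

namespace Summit.CriticalPhenomena.PercolationContinuityZ3.Theorems

namespace Quant

open Finset

/-- the two-point law `{lo, hi; g}` (as in `…QuantLawDEC`) -/
local notation3 "TP[" lo ", " hi ", " g ", " h "]" =>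
  (g : ℝ) * (if (h : ℕ) = (hi : ℕ) then (1 : ℝ) else 0) + (1 - (g : ℝ)) * (if (h : ℕ) = (lo : ℕ) then (1 : ℝ) else 0)

namespace LawDec

/-! ### The usage rates of the witness -/

/-- giants of layer `9` at floor `7/8` are used at rate `7`. [this work] -/
theorem usage_gsm_giant (T : ℝ) (l h : ℕ) (hh : 9 + 1 ≤ h) : usage (7 / 8 : ℝ) T 9 l h = 7 := by
  rw [usage_giant_eq _ _ _ _ _ hh]; norm_num

/-- `usage(3, 7) = 31` at `(7/8, 79/8, 9)` (heavy pair). [this work] -/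
theorem usage_gsm_37 : usage (7 / 8 : ℝ) (79 / 8) 9 3 7 = 31 := by
  rw [usage_mid_eq (7 / 8 : ℝ) (79 / 8) 9 3 7 (by norm_num) (by norm_num) (by norm_num) (by norm_num) (by norm_num)]
  norm_num

/-- `usage(3, 8) = 69/11` at `(7/8, 79/8, 9)` (light pair). [this work] -/
theorem usage_gsm_38 : usage (7 / 8 : ℝ) (79 / 8) 9 3 8 = 69 / 11 := by
  rw [usage_mid_eq (7 / 8 : ℝ) (79 / 8) 9 3 8 (by norm_num) (by norm_num) (by norm_num) (by norm_num) (by norm_num)]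
  norm_num

/-- `usage(3, 9) = 325/59` at `(7/8, 79/8, 9)` (light pair). [this work] -/
theorem usage_gsm_39 : usage (7 / 8 : ℝ) (79 / 8) 9 3 9 = 325 / 59 := by
  rw [usage_mid_eq (7 / 8 : ℝ) (79 / 8) 9 3 9 (by norm_num) (by norm_num) (by norm_num) (by norm_num) (by norm_num)]
  norm_num

/-! ### The refutation -/

/-- **`LawDec.GatedSliceMixLaw` IS FALSE AS TYPED** (see the file header for the witness and the price system; the corrected statement with
`W_h` non-DEC is `GatedSliceMixLaw'`). [this work] -/
theorem not_gatedSliceMixLaw : ¬ GatedSliceMixLaw := by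
  intro hL
  obtain ⟨θ, hθ0, hθ1, hdec⟩ := hL (7 / 8 : ℝ) 0 1 (63 / 8) (55 / 64) 2 9 9 9 1 9
    (by norm_num) (by norm_num) le_rfl (by norm_num) le_rfl (by norm_num) (by norm_num) (by norm_num) (by norm_num) (by norm_num)
    le_rfl le_rfl (by norm_num) (by norm_num) le_rfl (by norm_num) (by norm_num) (by norm_num)
  have eT : (63 / 8 : ℝ) + ((2 : ℕ) : ℝ) * 1 * (1 - 0) = 79 / 8 := by norm_num
  rw [eT] at hdec
  have hdual := dual_le_of_decAtT (7 / 8 : ℝ) (79 / 8) 9 (9 + 2) _ (by norm_num) (by norm_num) hdec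
    (fun l => if l = 0 ∨ l = 3 then 7 else 0)
    (fun h => if 9 + 1 ≤ h then 1 else if h = 7 ∨ h = 8 ∨ h = 9 then 2 else 0)
    (by intro h; split_ifs <;> norm_num) ?_
  · -- the two sides: 7θ/8 + 63(1−θ)/64 ≤ 7θ/8 + 55(1−θ)/64 forces θ ≥ 1
    simp only [Finset.sum_range_succ, Finset.sum_range_zero, weakMidLaw, slice] at hdual
    norm_num at hdual
    linarith
  · -- dual feasibility
    intro l h hl hlow hh hcomp
    have hβ : (0 : ℝ) ≤ (if 9 + 1 ≤ h then 1 else if h = 7 ∨ h = 8 ∨ h = 9 then 2 else 0) := by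
      split_ifs <;> norm_num
    by_cases hα : l = 0 ∨ l = 3
    · rw [if_pos hα]
      by_cases hg : 9 + 1 ≤ h
      · rw [usage_gsm_giant _ l h hg, if_pos hg]; norm_num
      · have hc : (79 / 8 : ℝ) < (l : ℝ) + h := hcomp.resolve_left hg
        have hh9 : h ≤ 9 := by omega
        rcases hα with rfl | rfl
        · -- l = 0: no compatible mid
          exfalso
          have : (79 / 8 : ℝ) < h := by simpa using hc
          have : (9 : ℝ) < h := by linarith
          have : 9 < h := by exact_mod_cast this
          omega
        · -- l = 3: compatible mids 7, 8, 9
          have hc' : (79 / 8 : ℝ) < 3 + (h : ℝ) := by simpa using hc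
          have h789 : h = 7 ∨ h = 8 ∨ h = 9 := by
            have : (55 / 8 : ℝ) < h := by linarith
            have : 6 < h := by exact_mod_cast (by linarith : (6 : ℝ) < h)
            omega
          rw [if_neg hg, if_pos h789]
          rcases h789 with rfl | rfl | rfl
          · rw [usage_gsm_37]; norm_num
          · rw [usage_gsm_38]; norm_num
          · rw [usage_gsm_39]; norm_num
    · rw [if_neg hα]
      have hlh : l < h := by
        rcases hcomp with hg | hc
        · omega
        · have : (l : ℝ) < h := by
            have h2 : 2 * (l : ℝ) < (l : ℝ) + h := lt_trans hlow hc
            linarith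
          exact_mod_cast this
      exact mul_nonneg (usage_pos_of_compat (7 / 8 : ℝ) (79 / 8) 9 l h (by norm_num) (by norm_num) hlow hlh hcomp).le hβ

end LawDec

end Quant

end Summit.CriticalPhenomena.PercolationContinuityZ3.Theorems
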